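import Mathlib
import HarnessLib
import Summits.Ventures.LatticeQCDFlow.Scoring.DoeblinPowerBatchMeansCLT
import Summits.Ventures.LatticeQCDFlow.Scoring.DoeblinPowerBatchMeansTauInt
import Summits.Ventures.LatticeQCDFlow.Exactness.MetropolisSweepErgodic

/-!
# THE COMPACT-GROUP METROPOLIS SWEEP (the engine's `sweep_metropolis`): CLT for time averages,
# consistent batch-means error bars, asymptotically exact coverage and a consistent `τ_int`, from
# ANY start — for every bounded observable, once the kicks of one link cover

HONEST FRAMING: exact (Metropolis-corrected) sampling algorithms for lattice gauge theory;
figures of merit are autocorrelation/cost numbers at stated couplings and volumes; no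
continuum-physics claim.

Venture `LatticeQCDFlow` (cell pub-lqcd), topic `Scoring`; FANOUT row 8 (`s0-cpn-nemc`, GEN-20).
NEW WORK of the cell, not a published result; no definition is introduced; nothing is cited as a
fact.  THE OBJECT IS ROW 9's: the Metropolis sweep `S = metropolisSweep ν w n L` on the configuration
space `ι → G` of a compact second-countable group (`Exactness/MetropolisSweepErgodic.lean`: visit the
links of the scan `L`, `n` random-walk Metropolis hits each with step law `ν`, joint weight `w`),
whose `(k+1)`-st POWER is Doeblin from every configuration once `k` kicks of one link cover
(`Exactness.metropolisSweep_nHit_minorised`: `(S^{k+1})(U, ·) ≥ ε · Haar^{⊗ι}`,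
`ε = ((m/M)^{n})^{|L|(k+1)} δ^{|ι|} > 0`) and which leaves `π = Z⁻¹ w · Haar^{⊗ι}` invariant
(`Exactness.metropolisSweep_invariant`).  Row 9 concluded uniform ergodicity and uniqueness of `π`.
This file adds the ERROR-BAR THEORY of the run `f(X_0), f(X_1), …` for every bounded measurable
observable `f` (a Wilson loop, the plaquette, a Polyakov loop) and EVERY initial law (cold or hot
start): the CLT `(√N)⁻¹ Σ_{t<N} (f(X_t) − πf) ⇒ N(0, σ²_f)` (row 13's CLT under a Doeblin power),
the consistency in probability of the batch-means estimator `a_N b_N · SE²_BM → σ²_f`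
(`Scoring/DoeblinPowerBatchMeans.lean`), the asymptotically exact coverage of
`f̄_N ± z σ̂_BM/√N` when `σ²_f > 0` (`Scoring/DoeblinPowerBatchMeansCLT.lean`), and the consistency of
the reported `τ̂_int = σ̂²_BM/(2 v̂)` when `Var_π f > 0` (`Scoring/DoeblinPowerBatchMeansTauInt.lean`).
The Wilson-action / `U(1)` / `SU(2)` instances are `Scoring/WilsonMetropolisSweepBatchMeans.lean`.

## Content (`G` compact second-countable group, `ι` finite; `ν` an inversion-invariant probability
## step law with `(mulWalk ν)^k(u, ·) ≥ δ · Haar`, `δ > 0`; `w` measurable, `0 < m ≤ w ≤ M`; `n ≥ 1`;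
## `L` through every link; `π = gibbsProbability Haar^{⊗ι} w`; `P_{μ₀}` the sweep chain's path law)

* `metropolisSweep_certificate` — the packaged hypotheses of the row's `…_of_nHit` theorems:
  `π` invariant and `ε • Haar^{⊗ι} ≤ (nHit S (k+1))(U, ·)` for all `U` with `0 < ε ≤ 1`;
* **`metropolisSweep_timeAverage_clt`** — `(√N)⁻¹ Σ_{t<N} (f(X_t) − πf) ⇒ N(0, σ²_f)` from any `μ₀`;
* **`metropolisSweep_batchMeans_tendstoInMeasure`** — `a_N b_N · SE²_BM → σ²_f` in probability;
* **`metropolisSweep_batchMeans_coverage`** — `σ²_f > 0`, `z > 0`: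
  `P_{μ₀}(|√N (f̄_N − πf)| ≤ z σ̂_BM) → (gaussianReal 0 1)[−z, z]`;
* **`metropolisSweep_tauInt_tendstoInMeasure`** — `Var_π f ≠ 0`: `σ̂²_BM/(2 v̂) → τ_int(ρ_f)` in probability.

NOT CLAIMED: any rate or any value of `ε`, `σ²_f`, `τ_int`; `σ²_f > 0` is assumed where stated;
unbounded observables; `SU(N ≥ 3)` kick covering (row 9's `SUNMetropolisSweepConvergence.lean`
handles convergence; the covering hypothesis is the same input here).
-/

noncomputable section

namespace Summit.Ventures.LatticeQCDFlow.Scoring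

open MeasureTheory ProbabilityTheory Filter Finset Preorder Literature.Probability.MarkovChains
open Literature.MathematicalPhysics.QuantumFieldTheory (haarProbability)
open scoped ENNReal Topology

section Sweep

variable {ι : Type*} [Fintype ι] [DecidableEq ι] {G : Type*} [TopologicalSpace G] [Group G]
  [IsTopologicalGroup G] [CompactSpace G] [MeasurableSpace G] [BorelSpace G] [SecondCountableTopology G]
  {ν : Measure G} [IsProbabilityMeasure ν] [ν.IsInvInvariant] {w : (ι → G) → ℝ} {m M : ℝ} {k : ℕ}
  {δ : ℝ≥0∞}

/-- **The certificate of the Metropolis sweep**, packaged for the row's `…_of_nHit` theorems: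
`π = Z⁻¹ w · Haar^{⊗ι}` is invariant under `S = metropolisSweep ν w n L`, and
`ε • Haar^{⊗ι} ≤ (nHit S (k+1))(U, ·)` for every `U` with `0 < ε ≤ 1`. -/
theorem metropolisSweep_certificate
    (hcov : ∀ u : G, δ • haarProbability G ≤ Exactness.nHit (Exactness.mulWalk ν) k u) (hδ : 0 < δ)
    (hw : Measurable w) (hm : 0 < m) (hwm : ∀ U, m ≤ w U) (hwM : ∀ U, w U ≤ M) {n : ℕ} (hn : 1 ≤ n)
    {L : List ι} (hL : ∀ j, j ∈ L) :
    Kernel.Invariant (Exactness.metropolisSweep ν w n L)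
        (Exactness.gibbsProbability (Measure.pi fun _ : ι => haarProbability G) w) ∧
      ∃ ε : ℝ≥0∞, 0 < ε ∧ ε ≤ 1 ∧ ∀ U : ι → G,
        ε • Measure.pi (fun _ : ι => haarProbability G)
          ≤ Exactness.nHit (Exactness.metropolisSweep ν w n L) (k + 1) U := by
  haveI := Exactness.isMarkovKernel_metropolisSweep ν hw n L
  haveI : IsMarkovKernel (Exactness.nHit (Exactness.metropolisSweep ν w n L) (k + 1)) :=
    Exactness.isMarkovKernel_nHit _ _
  have hw0 : ∀ U, 0 < w U := fun U => hm.trans_le (hwm U)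
  have hmin := Exactness.metropolisSweep_nHit_minorised hcov hw hm hwm hwM hn hL
  have hε0 := Exactness.metropolisSweep_const_pos (k := k) hδ hm hwm hwM n L
  have hε1 : ((ENNReal.ofReal (m / M) ^ n) ^ L.length) ^ (k + 1) * δ ^ Fintype.card ι ≤ 1 := by
    have h := Measure.le_iff'.1 (hmin 1) Set.univ
    rwa [Measure.smul_apply, smul_eq_mul, measure_univ, measure_univ, mul_one] at h
  exact ⟨Exactness.invariant_gibbsProbability (Exactness.metropolisSweep_invariant ν hw hw0 n L),
    _, hε0, hε1, hmin⟩

/-- **THE CLT FOR TIME AVERAGES OF THE METROPOLIS SWEEP, FROM EVERY INITIAL LAW**: for `|f| ≤ C`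
measurable and `Y ~ N(0, σ²_f)` (Green–Kubo variance under `π = Z⁻¹ w · Haar^{⊗ι}`):
`(√N)⁻¹ Σ_{t<N} (f(X_t) − πf) ⇒ Y` under `P_{μ₀}`. -/
theorem metropolisSweep_timeAverage_clt
    (hcov : ∀ u : G, δ • haarProbability G ≤ Exactness.nHit (Exactness.mulWalk ν) k u) (hδ : 0 < δ)
    (hw : Measurable w) (hm : 0 < m) (hwm : ∀ U, m ≤ w U) (hwM : ∀ U, w U ≤ M) {n : ℕ} (hn : 1 ≤ n)
    {L : List ι} (hL : ∀ j, j ∈ L) {f : (ι → G) → ℝ} (hf : Measurable f) {C : ℝ}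
    (hC : ∀ U, |f U| ≤ C) (μ₀ : Measure (ι → G)) [IsProbabilityMeasure μ₀]
    {Ω' : Type*} [MeasurableSpace Ω'] {P' : Measure Ω'} [IsProbabilityMeasure P'] {Y : Ω' → ℝ}
    (hY : HasLaw Y (gaussianReal 0 (Real.toNNReal
      ((∫ y, (f y - ∫ z, f z ∂(Exactness.gibbsProbability (Measure.pi fun _ : ι => haarProbability G) w)) ^ 2
          ∂(Exactness.gibbsProbability (Measure.pi fun _ : ι => haarProbability G) w))
        + 2 * ∑' j, ∫ y, (f y - ∫ z, f z ∂(Exactness.gibbsProbability (Measure.pi fun _ : ι => haarProbability G) w))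
          * (kop (Exactness.metropolisSweep ν w n L))^[j + 1]
            (fun y => f y - ∫ z, f z ∂(Exactness.gibbsProbability (Measure.pi fun _ : ι => haarProbability G) w)) y
          ∂(Exactness.gibbsProbability (Measure.pi fun _ : ι => haarProbability G) w)))) P')
    [hK : IsMarkovKernel (Exactness.metropolisSweep ν w n L)]
    [IsProbabilityMeasure (Kernel.trajMeasure (X := fun _ : ℕ => ι → G) μ₀
        (fun t : ℕ => (Exactness.metropolisSweep ν w n L).comap
          (fun h : (i : ↥(Finset.Iic t)) → (ι → G) => h ⟨t, Finset.mem_Iic.2 le_rfl⟩)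
          (measurable_pi_apply _)))] :
    TendstoInDistribution (fun (N : ℕ) (x : ℕ → ι → G) =>
        (Real.sqrt N)⁻¹ * ∑ t ∈ Finset.range N,
          (f (x t) - ∫ z, f z ∂(Exactness.gibbsProbability (Measure.pi fun _ : ι => haarProbability G) w)))
      atTop Y (fun _ => (Kernel.trajMeasure (X := fun _ : ℕ => ι → G) μ₀
        (fun t : ℕ => (Exactness.metropolisSweep ν w n L).comap
          (fun h : (i : ↥(Finset.Iic t)) → (ι → G) => h ⟨t, Finset.mem_Iic.2 le_rfl⟩)
          (measurable_pi_apply _)))) P' := by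
  haveI := Exactness.isProbabilityMeasure_gibbsProbability
    (μ := Measure.pi fun _ : ι => haarProbability G) hm hwm hwM
  obtain ⟨hπ, ε, hε0, -, hmin⟩ := metropolisSweep_certificate hcov hδ hw hm hwm hwM hn hL
  exact Exactness.GeneralNCMC.tendstoInDistribution_timeAverage_of_nHit hπ hε0.ne' hmin
    (Nat.succ_pos k) hf hC μ₀ hY

/-- **BATCH MEANS ESTIMATE `σ²_f` CONSISTENTLY ALONG THE METROPOLIS SWEEP, FROM EVERY INITIAL
LAW**: `a_N b_N · SE²_BM → σ²_f` in probability as `a_N, b_N → ∞`. -/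
theorem metropolisSweep_batchMeans_tendstoInMeasure
    (hcov : ∀ u : G, δ • haarProbability G ≤ Exactness.nHit (Exactness.mulWalk ν) k u) (hδ : 0 < δ)
    (hw : Measurable w) (hm : 0 < m) (hwm : ∀ U, m ≤ w U) (hwM : ∀ U, w U ≤ M) {n : ℕ} (hn : 1 ≤ n)
    {L : List ι} (hL : ∀ j, j ∈ L) {f : (ι → G) → ℝ} (hf : Measurable f) {C : ℝ}
    (hC : ∀ U, |f U| ≤ C) (μ₀ : Measure (ι → G)) [IsProbabilityMeasure μ₀]
    {a b : ℕ → ℕ} (ha : Tendsto a atTop atTop) (hb : Tendsto b atTop atTop)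
    [hK : IsMarkovKernel (Exactness.metropolisSweep ν w n L)] :
    TendstoInMeasure (Kernel.trajMeasure (X := fun _ : ℕ => ι → G) μ₀
        (fun t : ℕ => (Exactness.metropolisSweep ν w n L).comap
          (fun h : (i : ↥(Finset.Iic t)) → (ι → G) => h ⟨t, Finset.mem_Iic.2 le_rfl⟩)
          (measurable_pi_apply _)))
      (fun (N : ℕ) (x : ℕ → ι → G) => ((b N * a N : ℕ) : ℝ)
        * replicaSEsq (fun j (x : ℕ → ι → G) =>
            (∑ i ∈ Finset.range (b N), f (x (b N * j + i))) / (b N)) (a N) x)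
      atTop (fun _ =>
        (∫ y, (f y - ∫ z, f z ∂(Exactness.gibbsProbability (Measure.pi fun _ : ι => haarProbability G) w)) ^ 2
          ∂(Exactness.gibbsProbability (Measure.pi fun _ : ι => haarProbability G) w))
        + 2 * ∑' j, ∫ y, (f y - ∫ z, f z ∂(Exactness.gibbsProbability (Measure.pi fun _ : ι => haarProbability G) w))
          * (kop (Exactness.metropolisSweep ν w n L))^[j + 1]
            (fun y => f y - ∫ z, f z ∂(Exactness.gibbsProbability (Measure.pi fun _ : ι => haarProbability G) w)) y
          ∂(Exactness.gibbsProbability (Measure.pi fun _ : ι => haarProbability G) w)) := by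
  haveI := Exactness.isProbabilityMeasure_gibbsProbability
    (μ := Measure.pi fun _ : ι => haarProbability G) hm hwm hwM
  obtain ⟨hπ, ε, hε0, hε1, hmin⟩ := metropolisSweep_certificate hcov hδ hw hm hwm hwM hn hL
  exact chain_batchMeans_sigmaHat_tendstoInMeasure_of_nHit hπ
    (Exactness.GeneralNCMC.minorised_setwise hmin) hε0 hε1 (Nat.succ_pos k) hf hC μ₀ ha hb

/-- **THE COIN-FREE BATCH-MEANS INTERVAL OF A METROPOLIS-SWEEP RUN IS ASYMPTOTICALLY EXACT**
(`σ²_f > 0`, `a_N, b_N → ∞`, any initial law): for `z > 0` the probability of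
`|(√N')⁻¹ Σ_{t<N'} (f(X_t) − πf)| ≤ z σ̂` tends to `(gaussianReal 0 1)[−z, z]`, `N' = b_N a_N`. -/
theorem metropolisSweep_batchMeans_coverage
    (hcov : ∀ u : G, δ • haarProbability G ≤ Exactness.nHit (Exactness.mulWalk ν) k u) (hδ : 0 < δ)
    (hw : Measurable w) (hm : 0 < m) (hwm : ∀ U, m ≤ w U) (hwM : ∀ U, w U ≤ M) {n : ℕ} (hn : 1 ≤ n)
    {L : List ι} (hL : ∀ j, j ∈ L) {f : (ι → G) → ℝ} (hf : Measurable f) {C : ℝ}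
    (hC : ∀ U, |f U| ≤ C)
    (hσ : 0 < (∫ y, (f y - ∫ z, f z ∂(Exactness.gibbsProbability (Measure.pi fun _ : ι => haarProbability G) w)) ^ 2
          ∂(Exactness.gibbsProbability (Measure.pi fun _ : ι => haarProbability G) w))
        + 2 * ∑' j, ∫ y, (f y - ∫ z, f z ∂(Exactness.gibbsProbability (Measure.pi fun _ : ι => haarProbability G) w))
          * (kop (Exactness.metropolisSweep ν w n L))^[j + 1]
            (fun y => f y - ∫ z, f z ∂(Exactness.gibbsProbability (Measure.pi fun _ : ι => haarProbability G) w)) y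
          ∂(Exactness.gibbsProbability (Measure.pi fun _ : ι => haarProbability G) w))
    (μ₀ : Measure (ι → G)) [IsProbabilityMeasure μ₀]
    {a b : ℕ → ℕ} (ha : Tendsto a atTop atTop) (hb : Tendsto b atTop atTop) {z : ℝ} (hz : 0 < z)
    [hK : IsMarkovKernel (Exactness.metropolisSweep ν w n L)] :
    Tendsto (fun N : ℕ => (Kernel.trajMeasure (X := fun _ : ℕ => ι → G) μ₀
        (fun t : ℕ => (Exactness.metropolisSweep ν w n L).comap
          (fun h : (i : ↥(Finset.Iic t)) → (ι → G) => h ⟨t, Finset.mem_Iic.2 le_rfl⟩)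
          (measurable_pi_apply _))).real
      {x | |((Real.sqrt ((b N * a N : ℕ) : ℝ))⁻¹
          * ∑ t ∈ Finset.range (b N * a N),
            (f (x t) - ∫ z, f z ∂(Exactness.gibbsProbability (Measure.pi fun _ : ι => haarProbability G) w)))
        / Real.sqrt (((b N * a N : ℕ) : ℝ)
          * replicaSEsq (fun j (x : ℕ → ι → G) =>
              (∑ i ∈ Finset.range (b N), f (x (b N * j + i))) / (b N)) (a N) x)| ≤ z})
      atTop (𝓝 ((gaussianReal 0 1).real (Set.Icc (-z) z))) := by
  haveI := Exactness.isProbabilityMeasure_gibbsProbability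
    (μ := Measure.pi fun _ : ι => haarProbability G) hm hwm hwM
  obtain ⟨hπ, ε, hε0, hε1, hmin⟩ := metropolisSweep_certificate hcov hδ hw hm hwm hwM hn hL
  exact doeblinPower_batchMeans_studentized_coverage hπ hmin hε0 hε1 (Nat.succ_pos k) hf hC hσ μ₀
    ha hb hz

/-- **THE REPORTED `τ̂_int = σ̂²_BM/(2 v̂)` OF A METROPOLIS-SWEEP RUN IS CONSISTENT** (`Var_π f ≠ 0`,
`a_N, b_N → ∞`, any initial law): `σ̂²/(2 v̂) → τ_int(ρ_f) = 1/2 + Σ_{t≥1} ρ_f(t)` in probability. -/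
theorem metropolisSweep_tauInt_tendstoInMeasure
    (hcov : ∀ u : G, δ • haarProbability G ≤ Exactness.nHit (Exactness.mulWalk ν) k u) (hδ : 0 < δ)
    (hw : Measurable w) (hm : 0 < m) (hwm : ∀ U, m ≤ w U) (hwM : ∀ U, w U ≤ M) {n : ℕ} (hn : 1 ≤ n)
    {L : List ι} (hL : ∀ j, j ∈ L) {f : (ι → G) → ℝ} (hf : Measurable f) {C : ℝ}
    (hC : ∀ U, |f U| ≤ C)
    (hvar : autocov (Exactness.metropolisSweep ν w n L)
      (Exactness.gibbsProbability (Measure.pi fun _ : ι => haarProbability G) w)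
      (fun y => f y - ∫ z, f z ∂(Exactness.gibbsProbability (Measure.pi fun _ : ι => haarProbability G) w)) 0 ≠ 0)
    (μ₀ : Measure (ι → G)) [IsProbabilityMeasure μ₀]
    {a b : ℕ → ℕ} (ha : Tendsto a atTop atTop) (hb : Tendsto b atTop atTop)
    [hK : IsMarkovKernel (Exactness.metropolisSweep ν w n L)] :
    TendstoInMeasure (Kernel.trajMeasure (X := fun _ : ℕ => ι → G) μ₀
        (fun t : ℕ => (Exactness.metropolisSweep ν w n L).comap
          (fun h : (i : ↥(Finset.Iic t)) → (ι → G) => h ⟨t, Finset.mem_Iic.2 le_rfl⟩)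
          (measurable_pi_apply _)))
      (fun (N : ℕ) (x : ℕ → ι → G) =>
        (((b N * a N : ℕ) : ℝ)
          * replicaSEsq (fun j (x : ℕ → ι → G) =>
              (∑ i ∈ Finset.range (b N), f (x (b N * j + i))) / (b N)) (a N) x)
        / (2 * ((∑ t ∈ Finset.range (b N * a N), f (x t) ^ 2) / ((b N * a N : ℕ) : ℝ)
            - ((∑ t ∈ Finset.range (b N * a N), f (x t)) / ((b N * a N : ℕ) : ℝ)) ^ 2)))
      atTop (fun _ => tauInt (fun t =>
        autocov (Exactness.metropolisSweep ν w n L)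
          (Exactness.gibbsProbability (Measure.pi fun _ : ι => haarProbability G) w)
          (fun y => f y - ∫ z, f z ∂(Exactness.gibbsProbability (Measure.pi fun _ : ι => haarProbability G) w)) t
        / autocov (Exactness.metropolisSweep ν w n L)
          (Exactness.gibbsProbability (Measure.pi fun _ : ι => haarProbability G) w)
          (fun y => f y - ∫ z, f z ∂(Exactness.gibbsProbability (Measure.pi fun _ : ι => haarProbability G) w)) 0)) := by
  haveI := Exactness.isProbabilityMeasure_gibbsProbability
    (μ := Measure.pi fun _ : ι => haarProbability G) hm hwm hwM
  obtain ⟨hπ, ε, hε0, hε1, hmin⟩ := metropolisSweep_certificate hcov hδ hw hm hwm hwM hn hL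
  exact chain_batchMeans_tauInt_tendstoInMeasure_of_nHit hπ hmin hε0 hε1 (Nat.succ_pos k) hf hC hvar
    μ₀ ha hb

end Sweep

end Summit.Ventures.LatticeQCDFlow.Scoring

end
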